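import Summits.NavierStokesRegularity.FluidComputer.DIVec
import Summits.NavierStokesRegularity.FluidComputer.ChainFieldI
import Summits.NavierStokesRegularity.FluidComputer.RowDefect
import HarnessLib

/-!
# The ramp-enclosure ROW CHECK, executable half: the kernel's `row_check` in Lean
# (`pub-fluidc-bp3/R1-DESIGN.md` §9.4, layer B of `structure Row`; soundness `Row.sound` is the next file)

HONEST FRAMING (cell `pub-fluidc`, blueprint seat bp3, gen 20): low prior, high value-of-information
experiment on Tao's machine paradigm; NOT a claim that NS blows up. Integer bookkeeping only.

A bit-exact transcription of `code/thgate/g19/kgen19.py::row_check` (minus its float-only proposal steps,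
which become INPUT tables: the a-priori boxes `Wbar`, `Eb = Ē·2^P`, the resolvent majorant `E`, the block
exponent `msub`, the class radii `DEL`) over the primitives `DIVec` (interval linear algebra, Horner,
sub-intervals), `ChainField.{JmatI, FabsB, defectBound}`: reference range `XI`/`DXI`, phase speed `Φ` and
`P̃`, frame differences and hulls, `Ȧ = ΔA/H`, the residual `R = I − T̂A` by the exact identity
`R(v) = (1−v)R₀ + vR₁ + v(1−v)ΔT̂ΔA`, the closure test, `FQ`, `DB`, the phase-rate radius `ρ`, the coefficient
enclosure `K = ȦG + ṡ·AP̃JG` hulled over the `KSUB` sub-intervals with the forcing coefficients `CF`, `APTM`,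
the shift `c` and hull `B`, the forcing `φ`, the exact check `I + hBE ≤ E`, `η, η'`, the decayed / no-decay
squaring chains, the block iteration `u_next`, `u_sup` and the box test `u_sup < Wbar`. Every intermediate
matrix / vector is TABULATED (`Tab`, `Vec` = nested `Vector`s) so that evaluation shares work exactly as the
kernel does. `rowCheck` returns the derived record; `rowOK` is the conjunction the kernel asserts. Tested
bit-exactly against the kernel's integers on row 0 of the table of record: `g20/Row0Pipeline.selftest.lean`.

[cite: Tao2016AveragedNS, §5.5 Thm 5.3 (5.5)]
-/

namespace Summit.NavierStokesRegularity.FluidComputer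

open Literature.Analysis.FluidPDE.FluidComputer
open Literature.Analysis.ValidatedNumerics.Numerics (cdiv)

namespace RowCheck

open DIVec ChainField

/-! ### Tabulated matrices and vectors, integer helpers -/

/-- A tabulated `n × m` table. [folklore] -/
abbrev Tab (α : Type) (n m : ℕ) := Vector (Vector α m) n
/-- A tabulated vector. [folklore] -/
abbrev Vec (α : Type) (n : ℕ) := Vector α n

/-- Tabulate a matrix-valued function. [folklore] -/
def Tab.mk' {α : Type} {n m : ℕ} (f : Fin n → Fin m → α) : Tab α n m :=
  Vector.ofFn fun i => Vector.ofFn (f i)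
/-- Entry `(i, j)`. [folklore] -/
def Tab.at {α : Type} {n m : ℕ} (M : Tab α n m) (i : Fin n) (j : Fin m) : α := (M.get i).get j
/-- Tabulate a vector-valued function. [folklore] -/
def Vec.mk' {α : Type} {n : ℕ} (f : Fin n → α) : Vec α n := Vector.ofFn f

/-- `2^P` as an integer. [folklore] -/
def one (P : ℕ) : ℤ := (2 : ℤ) ^ P

/-- `Σ_{i<n} f i` over `Fin n`, integers (left fold). [folklore] -/
def sumZ : (n : ℕ) → (Fin n → ℤ) → ℤ
  | 0, _ => 0
  | n + 1, f => sumZ n (fun i => f (Fin.castSucc i)) + f (Fin.last n)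

/-- `max_{i<n} f i` with floor `b`. [folklore] -/
def maxZ : (n : ℕ) → ℤ → (Fin n → ℤ) → ℤ
  | 0, b, _ => b
  | n + 1, b, f => max (maxZ n b (fun i => f (Fin.castSucc i))) (f (Fin.last n))

/-- The smallest `P`-interval containing a rational (`di.of_frac`). [folklore] -/
def ofFrac (P : ℕ) (q : ℚ) : DI := ⟨⌊q * 2 ^ P⌋, ⌈q * 2 ^ P⌉⟩

/-- Identity interval matrix entry. [folklore] -/
def eyeI (P : ℕ) {n : ℕ} (i j : Fin n) : DI := if i = j then ⟨one P, one P⟩ else DI.pt 0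

/-- Tabulated interval matrix product. [folklore] -/
def mulT (P : ℕ) {n m l : ℕ} (A : Tab DI n m) (B : Tab DI m l) : Tab DI n l :=
  Tab.mk' (DIVec.mul P A.at B.at)

/-- Rounded-up integer matrix product `⌈Σ_j A_ij B_jk / 2^P⌉` (`mm_up`), tabulated. [folklore] -/
def mmUp (P : ℕ) {n : ℕ} (A B : Tab ℤ n n) : Tab ℤ n n :=
  Tab.mk' fun i k => cdiv (sumZ n fun j => A.at i j * B.at j k) (one P)

/-- Rounded-up integer matrix × vector (`mv_up`), tabulated. [folklore] -/
def mvUp (P : ℕ) {n : ℕ} (A : Tab ℤ n n) (v : Vec ℤ n) : Vec ℤ n :=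
  Vec.mk' fun i => cdiv (sumZ n fun j => A.at i j * v.get j) (one P)

/-! ### Input tables of a row -/

/-- The INPUT tables of one macro row (kernel `row` + driver state + proposals). [folklore] -/
structure RowData where
  /-- precision -/
  P : ℕ
  /-- reference polynomial degree -/
  DEG : ℕ
  /-- sub-intervals for the coefficient enclosures -/
  KSUB : ℕ
  /-- squarings (substep `h = H / 2^S`) -/
  S : ℕ
  /-- block exponent (`2^msub` blocks) -/
  msub : ℕ
  /-- phase coordinate -/
  p : Fin 9
  /-- row length (exact rational) -/
  Hq : ℚ
  /-- upstream interval couplings -/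
  cU : GateDataI
  /-- downstream interval couplings (`∋ Λ·g`) -/
  cD : GateDataI
  /-- upstream exact couplings -/
  qU : Fin 6 → ℚ
  /-- downstream exact couplings -/
  qD : Fin 6 → ℚ
  /-- reference coefficients (exact), per coordinate -/
  CQ : Fin 9 → List ℚ
  /-- frame at the row start (slot rows), intervals -/
  A0I : Fin 9 → Fin 9 → DI
  /-- frame at the row end -/
  A1I : Fin 9 → Fin 9 → DI
  /-- approximate inverse at the row start -/
  T0I : Fin 9 → Fin 9 → DI
  /-- approximate inverse at the row end -/
  T1I : Fin 9 → Fin 9 → DI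
  /-- start box (slot widths ·2^P; entry `p` unused) -/
  u : Fin 9 → ℤ
  /-- a-priori frame box (proposal) -/
  Wbar : Fin 9 → ℤ
  /-- a-priori deviation box `Ē·2^P` (proposal, `Eb p = 0`) -/
  Eb : Fin 9 → ℤ
  /-- defect class radii `δ·2^P` -/
  DEL : Fin 9 → ℤ
  /-- resolvent majorant proposal (slots `1..8`) -/
  E : Fin 8 → Fin 8 → ℤ

namespace RowData

variable (r : RowData)

/-- Coefficient intervals `CI = of_frac CQ`. [folklore] -/
def CI (i : Fin 9) : List DI := (r.CQ i).map (ofFrac r.P)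

/-- Derivative coefficient intervals `DI_ = of_frac (m · CQ_m)`, `m = 1 … DEG`. [folklore] -/
def DIc (i : Fin 9) : List DI :=
  ((List.range r.DEG).map fun (m : ℕ) => ofFrac r.P (((m : ℚ) + 1) * (r.CQ i).getD (m + 1) 0))

/-- The row interval `U = [0, H]`. [folklore] -/
def U : DI := ⟨0, ⌈r.Hq * 2 ^ r.P⌉⟩

/-- `x̂(V)` by interval Horner, tabulated. [folklore] -/
def XIon (V : DI) : Vec DI 9 := Vec.mk' fun i => hornerL r.P (r.CI i) V

/-- `x̂'(V)`, tabulated. [folklore] -/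
def DXIon (V : DI) : Vec DI 9 := Vec.mk' fun i => hornerL r.P (r.DIc i) V

/-- Sign-definiteness of an interval (`posB Φ ∨ posB (−Φ)`). [folklore] -/
def signDef (Φ : DI) : Bool := Φ.posB || Φ.neg.posB

/-- The signed inverse of a sign-definite interval. [folklore] -/
def sInv (Φ : DI) : DI := if Φ.posB then Φ.inv r.P else (Φ.neg.inv r.P).neg

/-- `P̃ = I − x̂' e_pᵀ / Φ` on an interval (column `p`: `−x̂'_i/Φ`, `P̃_pp = 0`), tabulated. [folklore] -/
def PT (DX : Vec DI 9) (iΦ : DI) : Tab DI 9 9 := Tab.mk' fun i j =>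
  if j = r.p then (if i = r.p then DI.pt 0 else ((DX.get i).mul r.P iΦ).neg)
  else (if i = j then ⟨one r.P, one r.P⟩ else DI.pt 0)

/-- The row-constant derived matrices. [folklore] -/
structure Pre where
  /-- `ΔA = A₁ − A₀` -/
  dA : Tab DI 9 9
  /-- `ΔT̂` -/
  dT : Tab DI 9 9
  /-- `Ȧ = ΔA / H` -/
  AD : Tab DI 9 9
  /-- `T̂₀A₀` -/
  TA0 : Tab DI 9 9
  /-- `T̂₁A₁` -/
  TA1 : Tab DI 9 9
  /-- `ΔT̂ΔA` -/
  dTdA : Tab DI 9 9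

/-- Compute the row-constant matrices. [folklore] -/
def pre : Pre :=
  let P := r.P
  let dA : Tab DI 9 9 := Tab.mk' (subM r.A1I r.A0I)
  let dT : Tab DI 9 9 := Tab.mk' (subM r.T1I r.T0I)
  let iH := (ofFrac P r.Hq).inv P
  ⟨dA, dT, Tab.mk' fun i j => (dA.at i j).mul P iH, Tab.mk' (mul P r.T0I r.A0I), Tab.mk' (mul P r.T1I r.A1I),
   Tab.mk' (mul P dT.at dA.at)⟩

/-- `R` over the whole row: `hull(I − T̂₀A₀, I − T̂₁A₁) + [0, ¼]·ΔT̂ΔA`. [folklore] -/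
def RU (q : Pre) : Tab DI 9 9 := Tab.mk' fun i j =>
  (((eyeI r.P i j).sub (q.TA0.at i j)).hull ((eyeI r.P i j).sub (q.TA1.at i j))).add
    ((⟨0, (2 : ℤ) ^ (r.P - 2)⟩ : DI).mul r.P (q.dTdA.at i j))

/-- `|G|` with `G = hull(T̂₀, T̂₁)` restricted to the slot columns `1..8`. [folklore] -/
def Gabs (i : Fin 9) (j : Fin 8) : ℤ := ((r.T0I i j.succ).hull (r.T1I i j.succ)).mag

/-- The closure test `Σ|G|W̄ + Σ|R|Ē < Ē_k` (`k ≠ p`), `Ē_p = 0`. [folklore] -/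
def closOK (q : Pre) : Bool :=
  let R := r.RU q
  decide (r.Eb r.p = 0) &&
  decide (∀ k : Fin 9, k ≠ r.p →
    (sumZ 8 fun j => cdiv (r.Gabs k j * r.Wbar j.succ) (one r.P)) +
      (sumZ 9 fun l => cdiv ((R.at k l).mag * r.Eb l) (one r.P)) < r.Eb k)

/-- `FQ = Fabs_int(Ē)`, tabulated. [folklore] -/
def FQ : Vec ℤ 9 := Vec.mk' (FabsB r.P r.cU r.cD r.Eb)
/-- `DB` = the Bernstein defect bound, tabulated. [folklore] -/
def DB : Vec ℤ 9 := Vec.mk' (defectBound r.P r.DEG r.qU r.qD r.Hq r.CQ)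

/-- The derived data of the phase-rate step on the whole row. [folklore] -/
structure Phase where
  /-- `|Φ|_lo` -/
  PhiAbsLo : ℤ
  /-- `D_p` -/
  Dp : ℤ
  /-- `ρ ·2^P` -/
  rho : ℤ
  /-- sign-definiteness and `D_p < |Φ|_lo` held -/
  ok : Bool

/-- `D_p = Σ|J_pk|Ē_k + FQ_p + δ_p + DB_p`, `ρ = ⌈D_p / (|Φ|_lo − D_p)⌉`. [folklore] -/
def phase (FQ DB : Vec ℤ 9) : Phase :=
  let XI := r.XIon r.U
  let Φ := (r.DXIon r.U).get r.p
  let JI : Tab DI 9 9 := Tab.mk' (JmatI r.P r.cU r.cD XI.get)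
  let PhiAbsLo := min |Φ.lo| |Φ.hi|
  let Dp := (sumZ 9 fun k => cdiv ((JI.at r.p k).mag * r.Eb k) (one r.P)) + FQ.get r.p + r.DEL r.p + DB.get r.p
  ⟨PhiAbsLo, Dp, cdiv (Dp * one r.P) (PhiAbsLo - Dp), signDef Φ && decide (Dp < PhiAbsLo)⟩

/-- The derived data of one sub-interval (or of the accumulation over several). [folklore] -/
structure Sub where
  /-- `K` (slots) -/
  K : Tab DI 8 8
  /-- forcing coefficients `|ȦR| + (1+ρ)|AP̃JR|` -/
  CF : Tab ℤ 9 9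
  /-- `|AP̃|` -/
  APTM : Tab ℤ 9 9
  /-- sign-definiteness of `Φ` held -/
  ok : Bool

/-- The coefficient enclosure on sub-interval `a` (`K = ȦG + ṡ·AP̃JG`, `CF`, `APTM`). [folklore] -/
def sub (q : Pre) (rho : ℤ) (a : ℕ) : Sub :=
  let P := r.P
  let Ua := subI P r.Hq r.KSUB a
  let XIa := r.XIon Ua
  let DXIa := r.DXIon Ua
  let Φa := DXIa.get r.p
  let JIa : Tab DI 9 9 := Tab.mk' (JmatI P r.cU r.cD XIa.get)
  let PTa := r.PT DXIa (r.sInv Φa)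
  let va := ofFrac P ((a : ℚ) / r.KSUB)
  let vb := ofFrac P (((a : ℚ) + 1) / r.KSUB)
  let Aa : Tab DI 9 9 := Tab.mk' fun i j =>
    ((r.A0I i j).add (va.mul P (q.dA.at i j))).hull ((r.A0I i j).add (vb.mul P (q.dA.at i j)))
  let Ga : Tab DI 9 8 := Tab.mk' fun i j =>
    ((r.T0I i j.succ).add (va.mul P (q.dT.at i j.succ))).hull
      ((r.T0I i j.succ).add (vb.mul P (q.dT.at i j.succ)))
  let Va := va.hull vb
  let OmV := (⟨one P, one P⟩ : DI).sub Va
  let VV := Va.mul P OmV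
  let Ra : Tab DI 9 9 := Tab.mk' fun i j =>
    ((OmV.mul P ((eyeI P i j).sub (q.TA0.at i j))).add (Va.mul P ((eyeI P i j).sub (q.TA1.at i j)))).add
      (VV.mul P (q.dTdA.at i j))
  let SD : DI := ⟨one P - rho, one P + rho⟩
  let APt := mulT P Aa PTa
  let APJ := mulT P APt JIa
  let Ma := mulT P APJ Ga
  let K0a := mulT P q.AD Ga
  let ADR := mulT P q.AD Ra
  let APJR := mulT P APJ Ra
  ⟨Tab.mk' fun i j => (K0a.at i.succ j).add (SD.mul P (Ma.at i.succ j)),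
   Tab.mk' fun i k => (ADR.at i k).mag + cdiv ((one P + rho) * (APJR.at i k).mag) (one P),
   Tab.mk' fun i k => (APt.at i k).mag,
   signDef Φa⟩

/-- Hull / max over the sub-intervals `a < n`. [folklore] -/
def subsAcc (q : Pre) (rho : ℤ) : ℕ → Sub
  | 0 => ⟨Tab.mk' fun _ _ => DI.pt 0, Tab.mk' fun _ _ => 0, Tab.mk' fun _ _ => 0, true⟩
  | n + 1 =>
    let s := r.sub q rho n
    if n = 0 then s else
    let acc := subsAcc q rho n
    ⟨Tab.mk' fun i j => (acc.K.at i j).hull (s.K.at i j), Tab.mk' fun i k => max (acc.CF.at i k) (s.CF.at i k),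
     Tab.mk' fun i k => max (acc.APTM.at i k) (s.APTM.at i k), acc.ok && s.ok⟩

/-- The derived data of the whole row check. [folklore] -/
structure Out where
  /-- closure test held -/
  closOK : Bool
  /-- phase step -/
  ph : Phase
  /-- sub-interval accumulation -/
  sb : Sub
  /-- shift `c ·2^P` -/
  c : ℤ
  /-- coefficient hull `B` -/
  B : Tab ℤ 8 8
  /-- forcing `φ ·2^P` -/
  phi : Vec ℤ 8
  /-- substep `h ·2^P` -/
  hInt : ℤ
  /-- `h` is a `P`-dyadic -/
  hOK : Bool
  /-- `I + hBE ≤ E` held -/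
  eOK : Bool
  /-- `c h < 1` held -/
  chOK : Bool
  /-- `η ·2^P ≥ e^{-ch}` -/
  eta : ℤ
  /-- `η' ·2^P ≥ e^{ch}` -/
  etap : ℤ
  /-- end box -/
  uNext : Vec ℤ 8
  /-- sup box over the row -/
  uSup : Vec ℤ 8
  /-- `u_sup < W̄` held -/
  wOK : Bool

/-- `n`-fold squaring of a chain `(A, b) ↦ (A², Ab + b)` (rounded up). [folklore] -/
def squarings (P : ℕ) : ℕ → Tab ℤ 8 8 × Vec ℤ 8 → Tab ℤ 8 8 × Vec ℤ 8
  | 0, Ab => Ab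
  | n + 1, Ab =>
    let A := Ab.1
    let b := Ab.2
    let Ab' := mvUp P A b
    squarings P n (mmUp P A A, Vec.mk' fun i => Ab'.get i + b.get i)

/-- The block iteration: `n` applications of the decayed block map to `u`, recording the sup of the
no-decay images. [folklore] -/
def blocks (P : ℕ) (And : Tab ℤ 8 8) (bnd : Vec ℤ 8) (Adc : Tab ℤ 8 8) (bdc : Vec ℤ 8) :
    ℕ → Vec ℤ 8 × Vec ℤ 8 → Vec ℤ 8 × Vec ℤ 8
  | 0, us => us
  | n + 1, us =>
    let uu := us.1
    let usup := us.2
    let s1 := mvUp P And uu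
    let d1 := mvUp P Adc uu
    blocks P And bnd Adc bdc n
      (Vec.mk' fun i => d1.get i + bdc.get i, Vec.mk' fun i => max (usup.get i) (s1.get i + bnd.get i))

/-- **The row check** (`kgen19.row_check` after its proposals), all derived integers. [folklore] -/
def rowCheck : Out :=
  let P := r.P
  let q := r.pre
  let FQ := r.FQ
  let DB := r.DB
  let ph := r.phase FQ DB
  let sb := r.subsAcc q ph.rho r.KSUB
  let c := max 0 (maxZ 8 0 fun i => -(sb.K.at i i).lo)
  let B : Tab ℤ 8 8 := Tab.mk' fun i j => ((sb.K.at i j).add (if i = j then ⟨c, c⟩ else DI.pt 0)).mag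
  let onep := one P + ph.rho
  let phi : Vec ℤ 8 := Vec.mk' fun i => sumZ 9 fun k =>
    cdiv (sb.CF.at i.succ k * r.Eb k) (one P) +
      cdiv (cdiv (onep * sb.APTM.at i.succ k) (one P) * (FQ.get k + r.DEL k + DB.get k)) (one P)
  let hq : ℚ := r.Hq / 2 ^ r.S * 2 ^ P
  let hInt : ℤ := hq.num
  let E : Tab ℤ 8 8 := Tab.mk' r.E
  let eOK : Bool := decide (∀ i k : Fin 8,
    (if i = k then one P * one P * one P else 0) + hInt * (sumZ 8 fun j => B.at i j * E.at j k)
      ≤ E.at i k * one P * one P)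
  let ch := cdiv (c * hInt) (one P)
  let chlo := (c * hInt) / one P
  let eta := cdiv (one P * one P) (one P + chlo)
  let etap := cdiv (one P * one P) (one P - ch)
  let g : Vec ℤ 8 := Vec.mk' fun k => cdiv (hInt * cdiv (etap * phi.get k) (one P)) (one P)
  let Eg := mvUp P E g
  let Adec0 : Tab ℤ 8 8 := Tab.mk' fun i k => cdiv (eta * E.at i k) (one P)
  let bdec0 : Vec ℤ 8 := Vec.mk' fun i => cdiv (eta * Eg.get i) (one P)
  let dec := squarings P (r.S - r.msub) (Adec0, bdec0)
  let nd := squarings P (r.S - r.msub) (E, Eg)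
  let us := blocks P nd.1 nd.2 dec.1 dec.2 (2 ^ r.msub) (Vec.mk' fun i => r.u i.succ, Vec.mk' fun _ => 0)
  ⟨r.closOK q, ph, sb, c, B, phi, hInt, decide (hq.den = 1), eOK, decide (ch < one P), eta, etap, us.1, us.2,
   decide (∀ i : Fin 8, us.2.get i < r.Wbar i.succ)⟩

/-- Everything the kernel asserts for a row to pass. [folklore] -/
def Out.ok (o : Out) : Bool := o.closOK && o.ph.ok && o.sb.ok && o.hOK && o.eOK && o.chOK && o.wOK

/-- The row passes. [folklore] -/
def rowOK : Bool := r.rowCheck.ok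

end RowData

end RowCheck

end Summit.NavierStokesRegularity.FluidComputer
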